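import Summits.HodgeConjecture.HodgeConjecture.Theorems.F0P2oD7alphaMemDockOfRowsSigned        -- ★ p848433 (F0P2-p06 (g14)) B2: `stubD7αMemDockPerMeasureT_of_rowsSigned 𝔇 h hrecS` (the SIGNED-rows producer over ★ …OfRowsT at `Δ°`)
import Summits.HodgeConjecture.HodgeConjecture.Theorems.F0P2oD7alphaShapeOfRecordSCDSigned     -- (F0P2-p06 (g14)) `shape_xiPacketFamilyOfRecordSCD_of_packageTestSigned` (SIGNED SHAPE at the SCD record; ★ p843355 bridges)
import HarnessLib

/-!
# Crux `H413`, programme P2 — (D7α) «D7αᵀ AT RUNG 0, DRY TERM, **SIGNED**»: the node `StubD7αMemDockPerMeasureT` AT THE ROWS OF A KIT FAMILY OF RECORD WHOSE ξ-PACKETS ARE THE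
# SCD RECORD AT THE SIGNED-PACKAGE DATUM — SHAPE discharged; the closer supplies `keys`, `hQS`, the K-side identification, Haar ×2, H₇, (D-b)ᵀˢ

Cell `hodgecm-mathlib` (D-0151), FLOOR 0, crux item H413 = `stmt-HodgeConjecture-24833`, route of record `HCCMUnconditional`; programme P2, fallback road PKΠ
`Cruxes/H413/Lines/F0_P2PKPiRung4.lean` (node `stub_D7αMemDockμT : StubD7αMemDockPerMeasureT`); Day-X recipe of record AMENDED by LEAD F0P3a-plan (g13) T12-14 (3):
«D7αᵀ ⟸ ★ `stubD7αMemDockPerMeasureT_of_rowsSigned` (B2) ∘ closer rows, with `Δ := Δ°` inside the node's ∃» (F0P2-ref1 (g10) objection ⑧ r353: the closer's rung-0 exports are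
SIGNED at the factor of record `Δ‴`; the unsigned producer chain ★ `…OfRowsSCD` ∘ ★ `…OfRowsT` is not typable at them).  Seat F0P2-p06 (g14), organ (B2-SCD).  Helper file: THEOREMS
ONLY (no definition, no named fact, no instance, no notation, no `sorry`); `--supports stmt-HodgeConjecture-24833 --as helper`.  HONEST LABEL: HC_CM is proved only modulo the
printed citations (2 remaining named inputs hLiu418 24832, h413 24833) until rung 0 closes; this file discharges none of them — its hypotheses are the closer's fourteen ROWS and, per
(frame, μ), the rung-0 exports named below; it is instantiated only where the rung-0 choice is in scope (the closer's §D ∕ Day-X pen).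

WHAT — the SIGNED twin of ★ `F0P2oD7alphaMemDockOfRowsSCD.stubD7αMemDockPerMeasureT_of_rowsSCD` (:88–:180, F0P2-p01 (g9)).  ★ B2 `stubD7αMemDockPerMeasureT_of_rowsSigned 𝔇 h hrecS`
takes, per (frame, μ), record data `(Δ, mH, mG, νG, νH, μZ)` with FIVE clauses (H₄ᵀˢ) SIGNED SHAPE ∧ (H₅) Haar `μZ` ∧ (H₆) Haar `νG` ∧ (H₇) local Δ-transfer existence at non-split `v`
∧ (H₈ᵀˢ) the SIGNED print letter (D-b)ᵀˢ.  With the closer's ξ-packets the SCD record `xiPacketFamilyOfRecordSCD … μZ keys (hSCD_of_cmCharIdentityPackageTestSigned … hQS)` (★ p843355),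
the SIGNED SHAPE is `shape_xiPacketFamilyOfRecordSCD_of_packageTestSigned` — so (H₄ᵀˢ)–(H₆) are replaced here by the closer's ACTUAL exports:
  (K) `keys` (the Keys handle), (Qᵀˢ) `hQS : CMCharIdentityPackageTestSigned L H hH hHd νH νG μω hμu Δ mH mG` (★ `CharIdentityOnTestFunctionsSigned`, the `Rung0WitnessS.hQ` type), and
  (Ξ) `(kitFamilyOfRecord 𝔇 …).packFin = xiPacketFamilyOfRecordSCD … μZ keys (hSCD_of_cmCharIdentityPackageTestSigned … hQS)` (K-side identification),
with `hH := transpose_map_cmConjRingHom_eq_of_frame L ι H T hT`, `hHd := isUnit_det_of_frame L ι H T hT` (the frame's own witnesses).  The statement is ★ `…_of_rowsSCD`'s TEXT with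
exactly three token changes: `hQT : CMCharIdentityPackageTest …` ↦ `hQS : CMCharIdentityPackageTestSigned …`, `hSCD_of_cmCharIdentityPackageTest … hQT` ↦
`hSCD_of_cmCharIdentityPackageTestSigned … hQS`, `piSCompletion_isThetaTypeAtCMTest` ↦ `piSCompletion_isThetaTypeAtCMTestSigned`; conclusion the node BY NAME (unchanged).

* `stubD7αMemDockPerMeasureT_of_rowsSCDSigned 𝔇 h hrecSCDS : StubD7αMemDockPerMeasureT` — ★ B2 fed (H₄ᵀˢ) := `shape_xiPacketFamilyOfRecordSCD_of_packageTestSigned` transported along (Ξ);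
  (H₅)–(H₈ᵀˢ) passed through.  The Day-X term: `stubD7αMemDockPerMeasureT_of_rowsSCDSigned frameDataOfRung0 rows_of_rung0
  (fun L ι H T hT hdef h2 μω hμu hμω μ _ => ⟨Δ‴, mH, mG, νG, νH, μZ, isHaar_μZ, isHaar_νG, keys, hQS, rfl ∕ packFin-lemma, hex, fun e₁ dV hdV hdV0 g hg ξ => ‹LH10 head› …⟩)`.

References: [Rogawski1990] §12.2 (2) pp. 173–174; §13.1 Prop. 13.1.3 (d), Prop. 13.1.4 p. 199; §13.3 pp. 201–202; §4.9 Prop. 4.9.1 (a) p. 55; §14.6 p. 242.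
[GelbartRogawski1991] Lem. 5.1.2 p. 466; Thm. 5.1.1 p. 465.  [LanglandsShelstad1987] §1.
-/

set_option autoImplicit false
-- the mandated namespace repeats `HodgeConjecture.HodgeConjecture`, as in every `Theorems/*.lean` of this sub-problem
set_option linter.dupNamespace false

noncomputable section

open NumberField IsDedekindDomain MeasureTheory
open scoped Matrix ComplexOrder

namespace Summit.HodgeConjecture.HodgeConjecture.Cruxes.H413.F0P2oD7alphaMemDockOfRowsSCDSigned

open Literature.NumberTheory.Rogawski1990 Literature.NumberTheory.GaloisRepresentations
open Literature.NumberTheory.Automorphic Literature.NumberTheory.Automorphic.UnitaryGroup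
open Literature.NumberTheory.Automorphic.UnitaryGroup.CotangentForms
open Literature.RepresentationTheory.BorelWallach2000 Literature.RepresentationTheory.KonnoKonno2007
open Summit.HodgeConjecture.HodgeConjecture.Cruxes.H413.F0P3InnerFormClassificationV6 (Gp Places)
open Summit.HodgeConjecture.HodgeConjecture.Cruxes.H413.F0P3KitOfRecord (FrameData kitFamilyOfRecord)
open Summit.HodgeConjecture.HodgeConjecture.Cruxes.H413.F0P3XiArchPacketOfRecord (JInfNoDegOne DsInfNoDegOne)

/-! ## The node at the rows of a kit family of record whose ξ-packets are the SCD record at the SIGNED-package datum -/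

section PerMeasureSCDS

variable
  (𝔇 : ∀ (L : Type) [Field L] [NumberField L] [IsCMField L] (ι : L →+* ℂ) (H : Matrix (Fin 3) (Fin 3) L) (T : GL (Fin 3) ℂ)
    (hT : (T : Matrix (Fin 3) (Fin 3) ℂ)ᴴ * H.map ι * (T : Matrix (Fin 3) (Fin 3) ℂ) = Literature.Geometry.ComplexHyperbolic.BallModel.J),
    (∀ τ' : L →+* ℂ, InfinitePlace.mk τ' ≠ InfinitePlace.mk ι → (H.map τ').PosDef) →
    2 ≤ Module.finrank ℚ ↥(maximalRealSubfield L) →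
    ∀ (μ : Measure (Gp L H).automorphicQuotient) [(Gp L H).IsAutomorphicMeasure μ] (μω : HeckeCharacter L) (_hμu : μω.IsUnitary),
    (∀ x : Literature.NumberTheory.GaloisRepresentations.ideleGroup ↥(maximalRealSubfield L),
      μω (AdeleRing.ideleBaseChange (↥(maximalRealSubfield L)) L x) = quadraticHeckeCharCM L x) → FrameData L H ι T hT μ)
  (h : ∀ (L : Type) [Field L] [NumberField L] [IsCMField L] (ι : L →+* ℂ) (H : Matrix (Fin 3) (Fin 3) L) (T : GL (Fin 3) ℂ)
    (hT : (T : Matrix (Fin 3) (Fin 3) ℂ)ᴴ * H.map ι * (T : Matrix (Fin 3) (Fin 3) ℂ) = Literature.Geometry.ComplexHyperbolic.BallModel.J)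
    (hdef : ∀ τ' : L →+* ℂ, InfinitePlace.mk τ' ≠ InfinitePlace.mk ι → (H.map τ').PosDef) (h2 : 2 ≤ Module.finrank ℚ ↥(maximalRealSubfield L))
    (μ : Measure (Gp L H).automorphicQuotient) [(Gp L H).IsAutomorphicMeasure μ] (μω : HeckeCharacter L) (hμu : μω.IsUnitary)
    (hμω : ∀ x : Literature.NumberTheory.GaloisRepresentations.ideleGroup ↥(maximalRealSubfield L),
      μω (AdeleRing.ideleBaseChange (↥(maximalRealSubfield L)) L x) = quadraticHeckeCharCM L x),
    ∃ S₀ : Finset (Places L),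
    F0P3InnerFormClassificationV8.ClassificationKit.SpecPkg (kitFamilyOfRecord 𝔇 L ι H T hT hdef h2 μ μω hμu hμω) S₀ ∧
    (kitFamilyOfRecord 𝔇 L ι H T hT hdef h2 μ μω hμu hμω).TraceIdentity ∧
    F0P3InnerFormClassificationV8.ClassificationKit.FactorisationCls (kitFamilyOfRecord 𝔇 L ι H T hT hdef h2 μ μω hμu hμω) S₀ ∧
    (kitFamilyOfRecord 𝔇 L ι H T hT hdef h2 μ μω hμu hμω).SpectralSideGp ∧
    F0P3InnerFormClassificationV8.ClassificationKit.HatBounded (kitFamilyOfRecord 𝔇 L ι H T hT hdef h2 μ μω hμu hμω) S₀ ∧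
    F0P3InnerFormClassificationV8.ClassificationKit.UnrStarAlgebra (kitFamilyOfRecord 𝔇 L ι H T hT hdef h2 μ μω hμu hμω) S₀ ∧
    (kitFamilyOfRecord 𝔇 L ι H T hT hdef h2 μ μω hμu hμω).LinIndepS ∧
    F0P3InnerFormClassificationV8.ClassificationKit.UnitaryPacket (kitFamilyOfRecord 𝔇 L ι H T hT hdef h2 μ μω hμu hμω) S₀ ∧
    (kitFamilyOfRecord 𝔇 L ι H T hT hdef h2 μ μω hμu hμω).Routing ∧
    JInfNoDegOne (𝔇 L ι H T hT hdef h2 μ μω hμu hμω).jInf ∧ DsInfNoDegOne (𝔇 L ι H T hT hdef h2 μ μω hμu hμω).dsInf ∧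
    (kitFamilyOfRecord 𝔇 L ι H T hT hdef h2 μ μω hμu hμω).XiFamilyFin μω hμu ∧
    (kitFamilyOfRecord 𝔇 L ι H T hT hdef h2 μ μω hμu hμω).XiUnram ∧
    (kitFamilyOfRecord 𝔇 L ι H T hT hdef h2 μ μω hμu hμω).EvpConvention)

include h in
/-- **(D7α) «D7αᵀ AT RUNG 0, DRY TERM, SIGNED»: PKΠ's node `StubD7αMemDockPerMeasureT` AT THE ROWS OF A KIT FAMILY OF RECORD WHOSE ξ-PACKETS ARE THE SCD RECORD AT THE
SIGNED-PACKAGE DATUM.**  Per (frame, μ) the closer supplies `(Δ, mH, mG, νG, νH, μZ)` (`Δ` = the factor of record `Δ‴`), the Keys handle `keys`, the SIGNED Test package `hQS`,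
the K-side identification (Ξ), Haar ×2, (H₇) local Δ-transfer existence at non-split places and (H₈ᵀˢ) the SIGNED print letter (D-b)ᵀˢ; the SIGNED SHAPE is
`shape_xiPacketFamilyOfRecordSCD_of_packageTestSigned` transported along (Ξ), and everything else is ★ B2 `stubD7αMemDockPerMeasureT_of_rowsSigned` (which moves the sign into
print's factor `Δ° := fun v => (Δ v).constMul ↑(formSignAt L c H v)` and runs ★ producerᵀ there).
[cite: Rogawski1990, §13.1 Prop. 13.1.3 (d), Prop. 13.1.4 p. 199; §12.2 (2) pp. 173–174; §14.6 p. 242] [cite: GelbartRogawski1991, Lem. 5.1.2 p. 466; Thm. 5.1.1 p. 465]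
[cite: LanglandsShelstad1987, §1] -/
theorem stubD7αMemDockPerMeasureT_of_rowsSCDSigned
  (hrecSCDS : ∀ (L : Type) [Field L] [NumberField L] [IsCMField L] (ι : L →+* ℂ) (H : Matrix (Fin 3) (Fin 3) L) (T : GL (Fin 3) ℂ)
    (hT : (T : Matrix (Fin 3) (Fin 3) ℂ)ᴴ * H.map ι * (T : Matrix (Fin 3) (Fin 3) ℂ) = Literature.Geometry.ComplexHyperbolic.BallModel.J)
    (hdef : ∀ τ' : L →+* ℂ, InfinitePlace.mk τ' ≠ InfinitePlace.mk ι → (H.map τ').PosDef) (h2 : 2 ≤ Module.finrank ℚ ↥(maximalRealSubfield L))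
    (μω : HeckeCharacter L) (hμu : μω.IsUnitary)
    (hμω : ∀ x : Literature.NumberTheory.GaloisRepresentations.ideleGroup ↥(maximalRealSubfield L), μω (AdeleRing.ideleBaseChange (↥(maximalRealSubfield L)) L x) = quadraticHeckeCharCM L x)
    (μ : Measure (adelicGroupData (↥(maximalRealSubfield L)) L (IsCMField.complexConj L) 3 H).automorphicQuotient) [(adelicGroupData (↥(maximalRealSubfield L)) L (IsCMField.complexConj L) 3 H).IsAutomorphicMeasure μ],
    letI : ∀ v : HeightOneSpectrum (𝓞 ↥(maximalRealSubfield L)), MeasurableSpace ((cmDatum L 3 H).Local v) := fun _ => borel _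
    letI : ∀ v : HeightOneSpectrum (𝓞 ↥(maximalRealSubfield L)),
        MeasurableSpace ((cmDatum L 2 (Matrix.of fun i j : Fin 2 => if i.val + j.val + 1 = 2 then (1 : L) else 0)).Local v ×
          (cmDatum L 1 (Matrix.of fun i j : Fin 1 => if i.val + j.val + 1 = 1 then (1 : L) else 0)).Local v) := fun _ => borel _
    letI : ∀ (v : HeightOneSpectrum (𝓞 ↥(maximalRealSubfield L)))
        (a : ((cmDatum L 2 (Matrix.of fun i j : Fin 2 => if i.val + j.val + 1 = 2 then (1 : L) else 0)).Local v ×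
          (cmDatum L 1 (Matrix.of fun i j : Fin 1 => if i.val + j.val + 1 = 1 then (1 : L) else 0)).Local v)),
        MeasurableSpace (((cmDatum L 2 (Matrix.of fun i j : Fin 2 => if i.val + j.val + 1 = 2 then (1 : L) else 0)).Local v ×
            (cmDatum L 1 (Matrix.of fun i j : Fin 1 => if i.val + j.val + 1 = 1 then (1 : L) else 0)).Local v) ⧸
          Subgroup.centralizer ({a} : Set ((cmDatum L 2 (Matrix.of fun i j : Fin 2 => if i.val + j.val + 1 = 2 then (1 : L) else 0)).Local v ×
            (cmDatum L 1 (Matrix.of fun i j : Fin 1 => if i.val + j.val + 1 = 1 then (1 : L) else 0)).Local v))) := fun _ _ => borel _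
    letI : ∀ (v : HeightOneSpectrum (𝓞 ↥(maximalRealSubfield L))) (γ : (cmDatum L 3 H).Local v),
        MeasurableSpace ((cmDatum L 3 H).Local v ⧸ Subgroup.centralizer ({γ} : Set ((cmDatum L 3 H).Local v))) := fun _ _ => borel _
    letI : ∀ v : HeightOneSpectrum (𝓞 ↥(maximalRealSubfield L)), MeasurableSpace (Gqs L v ⧸ Subgroup.center (Gqs L v)) := fun _ => borel _
    ∃ (Δ : ∀ v : HeightOneSpectrum (𝓞 ↥(maximalRealSubfield L)), LocalTransferFactor L H v)
      (mH : ∀ v : HeightOneSpectrum (𝓞 ↥(maximalRealSubfield L)),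
    OrbitalMeasureFamily ((cmDatum L 2 (Matrix.of fun i j : Fin 2 => if i.val + j.val + 1 = 2 then (1 : L) else 0)).Local v ×
      (cmDatum L 1 (Matrix.of fun i j : Fin 1 => if i.val + j.val + 1 = 1 then (1 : L) else 0)).Local v))
      (mG : ∀ v : HeightOneSpectrum (𝓞 ↥(maximalRealSubfield L)), OrbitalMeasureFamily ((cmDatum L 3 H).Local v))
      (νG : ∀ v : HeightOneSpectrum (𝓞 ↥(maximalRealSubfield L)), Measure ((cmDatum L 3 H).Local v))
      (νH : ∀ v : HeightOneSpectrum (𝓞 ↥(maximalRealSubfield L)),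
    Measure ((cmDatum L 2 (Matrix.of fun i j : Fin 2 => if i.val + j.val + 1 = 2 then (1 : L) else 0)).Local v ×
      (cmDatum L 1 (Matrix.of fun i j : Fin 1 => if i.val + j.val + 1 = 1 then (1 : L) else 0)).Local v))
      (μZ : ∀ v : HeightOneSpectrum (𝓞 ↥(maximalRealSubfield L)), Measure (Gqs L v ⧸ Subgroup.center (Gqs L v))),
      -- (K) THE KEYS HANDLE and (Qᵀˢ) THE SIGNED TEST PACKAGE at these data (the closer's rung-0 exports `keys`, `hQS` — edition «QCMT SIGNED»), and
      -- (Ξ) the K-side identification: the kit family's finite ξ-packets ARE the SCD record at the datum read off `hQS` (★ `hSCD_of_cmCharIdentityPackageTestSigned`)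
      ∃ (hHaar : ∀ v : HeightOneSpectrum (𝓞 ↥(maximalRealSubfield L)), (μZ v).IsHaarMeasure)
        (_hνG : ∀ v : HeightOneSpectrum (𝓞 ↥(maximalRealSubfield L)), (νG v).IsHaarMeasure)
        (keys : ∀ (ξ : OneDimAutRepH L) (v : HeightOneSpectrum (𝓞 ↥(maximalRealSubfield L))),
        (∀ w : PlacesOver L v, IsCMField.complexConj L • w.1 = w.1) →
          {p : IrrClass (Gqs L v) × IrrClass (Gqs L v) //
            KeysCaseTwoLabels L v (μω.semilocalComponent L v) (torusLocalComponent L (IsCMField.complexConj L) v ξ.η)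
              (torusLocalComponent L (IsCMField.complexConj L) v ξ.ψ) p.1 p.2 ∧
            p.1.IsSquareIntegrable (μZ v) ∧ ¬ p.2.IsSquareIntegrable (μZ v)})
      (hQS : CMCharIdentityPackageTestSigned L H (transpose_map_cmConjRingHom_eq_of_frame L ι H T hT) (isUnit_det_of_frame L ι H T hT) νH νG μω hμu Δ mH mG),
      (haveI : ∀ v : HeightOneSpectrum (𝓞 ↥(maximalRealSubfield L)), (μZ v).IsHaarMeasure := hHaar
       haveI : ∀ v : HeightOneSpectrum (𝓞 ↥(maximalRealSubfield L)), BorelSpace (Gqs L v ⧸ Subgroup.center (Gqs L v)) := fun _ => ⟨rfl⟩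
       (kitFamilyOfRecord 𝔇 L ι H T hT hdef h2 μ μω hμu hμω).packFin =
        F0P3XiPacketFamilyOfRecordSCD.xiPacketFamilyOfRecordSCD L H (transpose_map_cmConjRingHom_eq_of_frame L ι H T hT) (isUnit_det_of_frame L ι H T hT)
          μω hμu μZ keys
          (F0P3XiPacketFamilyOfRecordSCD.hSCD_of_cmCharIdentityPackageTestSigned L H (transpose_map_cmConjRingHom_eq_of_frame L ι H T hT)
            (isUnit_det_of_frame L ι H T hT) μω hμu Δ mH mG νG νH μZ hQS)) ∧
      -- (H₇) `φ ↦ φ^H` exists on `C_c^∞` at every non-split finite place [Rogawski1990 Prop. 4.9.1 (a)] (the N6 #102 currency), at `Δ`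
      (∀ v : HeightOneSpectrum (𝓞 ↥(maximalRealSubfield L)), (∀ w : PlacesOver L v, IsCMField.complexConj L • w.1 = w.1) →
        IsLocalDeltaTransferExists L H v (Δ v) (mH v) (mG v) Literature.NumberTheory.Rogawski1990.IsLocSmooth
          Literature.NumberTheory.Rogawski1990.IsLocSmooth) ∧
      -- (H₈ᵀˢ) the SIGNED print letter (D-b)ᵀˢ ON TEST FUNCTIONS, BY NAME, at these data [GelbartRogawski1991 Lem. 5.1.2, Thm. 5.1.1; Rogawski1992 Thm. 1.1]
      (∀ {n' : ℕ} (e₁ : Fin 3 × Fin 1 ≃ Fin n') (dV : Fin 3 → L) (hdV : ∀ i, IsCMField.complexConj L (dV i) = dV i) (hdV0 : ∀ i, dV i ≠ 0) (g : GL (Fin 3) L)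
          (hg : ((g : Matrix (Fin 3) (Fin 3) L).map (cmConjRingHom L))ᵀ * H * (g : Matrix (Fin 3) (Fin 3) L) = Matrix.diagonal dV) (ξ : OneDimAutRepH L),
        Literature.NumberTheory.GelbartRogawski1991.piSCompletion_isThetaTypeAtCMTestSigned L H Δ mH mG νH νG ξ μω (fun v => ξ.xiLocalChar v) e₁ dV hdV hdV0 g hg)) :
    F0P2oD7alphaMemDockStatement.StubD7αMemDockPerMeasureT := by
  refine F0P2oD7alphaMemDockOfRowsSigned.stubD7αMemDockPerMeasureT_of_rowsSigned 𝔇 h ?_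
  intro L _ _ _ ι H T hT hdef h2 μω hμu hμω μ _
  obtain ⟨Δ, mH, mG, νG, νH, μZ, hHaar, hνG, keys, hQS, hpk, hex, hW⟩ := hrecSCDS L ι H T hT hdef h2 μω hμu hμω μ
  refine ⟨Δ, mH, mG, νG, νH, μZ, ?_, hHaar, hνG, hex, hW⟩
  -- SIGNED SHAPE at the SCD record (signed-package datum), transported along the K-side identification (Ξ); borel σ-algebras as in the node's `letI`s
  intro ξ v hns
  letI : ∀ v : HeightOneSpectrum (𝓞 ↥(maximalRealSubfield L)), MeasurableSpace ((cmDatum L 3 H).Local v) := fun _ => borel _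
  letI : ∀ v : HeightOneSpectrum (𝓞 ↥(maximalRealSubfield L)),
      MeasurableSpace ((cmDatum L 2 (Matrix.of fun i j : Fin 2 => if i.val + j.val + 1 = 2 then (1 : L) else 0)).Local v ×
        (cmDatum L 1 (Matrix.of fun i j : Fin 1 => if i.val + j.val + 1 = 1 then (1 : L) else 0)).Local v) := fun _ => borel _
  letI : ∀ (v : HeightOneSpectrum (𝓞 ↥(maximalRealSubfield L)))
      (a : ((cmDatum L 2 (Matrix.of fun i j : Fin 2 => if i.val + j.val + 1 = 2 then (1 : L) else 0)).Local v ×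
        (cmDatum L 1 (Matrix.of fun i j : Fin 1 => if i.val + j.val + 1 = 1 then (1 : L) else 0)).Local v)),
      MeasurableSpace (((cmDatum L 2 (Matrix.of fun i j : Fin 2 => if i.val + j.val + 1 = 2 then (1 : L) else 0)).Local v ×
          (cmDatum L 1 (Matrix.of fun i j : Fin 1 => if i.val + j.val + 1 = 1 then (1 : L) else 0)).Local v) ⧸
        Subgroup.centralizer ({a} : Set ((cmDatum L 2 (Matrix.of fun i j : Fin 2 => if i.val + j.val + 1 = 2 then (1 : L) else 0)).Local v ×
          (cmDatum L 1 (Matrix.of fun i j : Fin 1 => if i.val + j.val + 1 = 1 then (1 : L) else 0)).Local v))) := fun _ _ => borel _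
  letI : ∀ (v : HeightOneSpectrum (𝓞 ↥(maximalRealSubfield L))) (γ : (cmDatum L 3 H).Local v),
      MeasurableSpace ((cmDatum L 3 H).Local v ⧸ Subgroup.centralizer ({γ} : Set ((cmDatum L 3 H).Local v))) := fun _ _ => borel _
  letI : ∀ v : HeightOneSpectrum (𝓞 ↥(maximalRealSubfield L)), MeasurableSpace (Gqs L v ⧸ Subgroup.center (Gqs L v)) := fun _ => borel _
  haveI : ∀ v : HeightOneSpectrum (𝓞 ↥(maximalRealSubfield L)), BorelSpace (Gqs L v ⧸ Subgroup.center (Gqs L v)) := fun _ => ⟨rfl⟩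
  haveI : ∀ v : HeightOneSpectrum (𝓞 ↥(maximalRealSubfield L)), (μZ v).IsHaarMeasure := hHaar
  obtain ⟨Tv, a, ha, hc, π2, πn, πs, hK, hs2, hn, hsc, hne, hId, hP⟩ :=
    F0P2oD7alphaShapeOfRecordSCDSigned.shape_xiPacketFamilyOfRecordSCD_of_packageTestSigned L H (transpose_map_cmConjRingHom_eq_of_frame L ι H T hT)
      (isUnit_det_of_frame L ι H T hT) μω hμu Δ mH mG νG νH μZ keys hQS ξ v hns
  exact ⟨Tv, a, ha, hc, π2, πn, πs, hK, hs2, hn, hsc, hne, hId, by rw [hpk]; exact hP⟩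

end PerMeasureSCDS

end Summit.HodgeConjecture.HodgeConjecture.Cruxes.H413.F0P2oD7alphaMemDockOfRowsSCDSigned

end
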